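import Summits.Parity.GeneralizedHardyLittlewood.Theses.ParityLeakOneFifth

/-!
# Birth skeleton (BC3) — crux stmt-Parity-18381 `Theses.ParityLeakOneFifth.ParityLeakSieve` (rank 5)
# line `birth`: the zero-parity-defect lower-bound sieve at (γ, θ, ν) = (1/2, 0, 1/5) for the twin host

Registered by the skeleton registrar (planner one-shot `planner-skel-stmt-Parity-18381-0`, 2026-08-17;
BC3 of `run/shared/lean/lens3/_common/BC.md`). Route `route-Parity-ParityLeakOneFifth` (S2, the
UNCONDITIONAL sieve-theoretic half of the thesis: `E1NonSaturation → TwinLowerDensity`). Four NAMED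
stubs and the kernel-checked composition `ParityLeakSieve_of` concluding the crux BY NAME;
`parityLeakSieve_of_stubs` plugs the stubs in (and certifies that the hypotheses of
`ParityLeakSieve_of` are the stub signatures verbatim). `sorry` occurs ONLY inside the four `stub_*`
theorems.

## The crux (FIXED; verbatim the route decl)

`ParityLeakSieve : E1NonSaturation → TwinLowerDensity`. Notation of the route (the inline `let`s of
the route decls; in each stub the same dictionary is supplied as a β-redex
`(fun b a Φ Ψ => <inequality>) ⟨b⟩ ⟨a⟩ ⟨Φ⟩ ⟨Ψ⟩` with bodies closed in `x, ε` — definitionally (β/ζ) the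
route's `let` forms, see the `*_iff` bridges — because a registered stub signature may not contain
`let … :=`): on `n ∈ (x, 2x]`, host `a n = Λ'(n)` (`log n` at
primes), model `b n = 1[n is z-rough]/V(z)` with `z = exp((log log x)²)`,
`V(z) = ∏_{p<z}(1 − 1/p)`; sifted variable `m = n + 2`; `y = x^{1/5}`, `D = x^{1/2−2ε}`, `w = x^{ε²}`;
the truncated Möbius sum `M(m) = ∑_{d ∣ m, d ≤ D, (p ∣ d ⇒ p ≥ y)} μ(d)` (the (W1) weight at ν = 1/5);
`Φ(m) = 1[w ≤ P⁻(m) < y]·M(m)` (the route's Type-II type function), and — NEW in this skeleton, the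
only object not already in the route file — the DETECTED part `Ψ(m) = 1[P⁻(m) ≥ y]·M(m)`.
`W_Φ = ∑ Φ(n+2)(a n − b n)`, `Π = ∑ b n·λ(n+2)·Φ(n+2)`, model main term `𝔐 = ∑ b n·Ψ(n+2)`,
`T(x) = ∑_{x<n≤2x, n and n+2 prime} log n`.

## The cut — Θ = Φ + Ψ, a pointwise lower-bound sieve, and the parity line

Put `Θ(m) = 1[P⁻(m) ≥ w]·M(m) = Φ(m) + Ψ(m)`. POINTWISE, for `m ∈ (x+2, 2x+2]`:
`1[m prime] ≥ Ψ(m) − 32·1_E(m)` where `E` = {`m = p₁p₂` with `D < p₁ ≤ √m`} ∪ {`m = p₁⋯p₅`, all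
`pᵢ ≥ y`} ∪ {`m` `y`-rough, not squarefree} (case analysis on the `y`-rough type of `m`: `Ψ(p) = 1`;
`Ψ(p₁p₂) = 1[p₁ > D]`; `Ψ(p₁p₂p₃) ∈ {0, −1, −2}` according as `p₁p₂ ≤ D`, `D < p₁p₂ < m/D`,
`p₁p₂ ≥ m/D`; `Ψ(p₁p₂p₃p₄) = −#{complementary divisor pairs in the corner (D, m/D)} ≤ 0`;
`Ψ(P₅) = 6`; `Ψ = 0` off `y`-rough `m`). Summing against `a ≥ 0`:
`T(x) ≥ ∑ a·Θ(n+2) − ∑ a·Φ(n+2) − 32 ∑_{n+2 ∈ E} a n`, and (S1) `∑ (a − b)·Θ(n+2) = O(ε x/log x)`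
is TYPE-I information only: `Θ(m) = ∑_{d} μ(d)·1[P⁻(m/d) ≥ w]`, the `w`-sieve of `m/d` has level
`x^{ε} = w^{1/ε}` to spare (fundamental lemma, error `e^{−1/ε} ε^{−2} = o(ε)`), and the remainders
`d·e ≤ x^{1/2−ε}` are Bombieri–Vinogradov (host) / equidistribution of `z`-rough integers (model);
`∑_{n+2∈E} a n = O(ε x/log x)` by a 2-dimensional upper-bound sieve on the corner `p₁ ∈ (D, √(2x)]`
(∑ 1/p₁ ≈ 4ε) plus trivial bounds (`P₅`: `O(x/log⁴x)`; non-squarefree: `O(x^{4/5} log x)`). Since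
`∑ b·Θ − ∑ b·Φ = 𝔐` exactly, this is stub S1: `T ≥ 𝔐 − W_Φ − δ·x/log x`.
ZERO PARITY DEFECT (S2): `𝔐 − Π = ∑ b·(1 + λ(n+2))·Ψ(n+2) − ∑ b·λ(n+2)·Θ(n+2)`; the first sum
vanishes identically on squarefree `y`-rough `m` with an odd number of prime factors (there
`1 + λ = 0`) and on the generic even types (`Ψ = 0`), leaving the `O(ε)` corners; the second is
`λ` summed over `w`-rough cofactors with `u = log(x/d)/log w ≥ 1/(2ε²)` (Alladi / de Bruijn:
`∑_{k ≤ K, P⁻(k) ≥ w} λ(k) ≈ (K/log w)·ρ′(u)`, super-exponentially small), in progressions to the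
tiny moduli of the `z`-sieve of `n = m − 2` (level `z^{v}`, `v → ∞`). So `𝔐 = Π + O(ε x/log x)`:
the inequality of S1 is TIGHT on Bombieri's parity line `a = b(1 + λ(n+2))` (`T = 0`, `W_Φ = Π`).
CALIBRATION (S3): `Π = 𝔖₂·(1 − 2M₃(1/5) − O(ε) + o(1))·x/log x` with `𝔖₂ = 2C₂` (the factor
`1/V(z)` against the density of `m − 2` `z`-rough along primes / `P₃`'s) and
`M₃(ν) = ∬_{ν ≤ β₁ ≤ β₂ ≤ β₃ ≤ 1/2, Σβ = 1} dβ₁dβ₂/(β₁β₂β₃)`, `M₃(1/5) = 0.3189…`, so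
`1 − 2M₃(1/5) = 0.362… = C⁻(1/2, 0, 1/5)` of Ford–Maynard [arXiv:2407.14368, Thm 2.7(a)] (the loss
`2` per `P₃` with `p₃ ≤ x^{1/2}` is exactly `Ψ(p₁p₂p₃) = −2`): `Π ≥ c₀ x/log x`.
WINDOW TO DENSITY (S4): `T(x) ≥ c·x/log x` eventually ⇒ `π₂(x) ≥ #{twins in (⌊x/2⌋, 2⌊x/2⌋]}
≥ T(⌊x/2⌋)/log x ≥ (c/3)·x/log²x`.
COMPOSITION (`ParityLeakSieve_of`, no `sorry`): from `E1NonSaturation` take `η, ε₁`; from S3 take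
`c₀, ε₃`; feed `δ = ηc₀/4` to S1 and S2; at `ε = min(ε₁, ε₂, ε₂′, ε₃)` and `x ≥ max x₀`'s,
`T ≥ 𝔐 − W_Φ − δX ≥ (Π − δX) − (1 − η)Π − δX = ηΠ − 2δX ≥ ηc₀X − 2δX = (ηc₀/2)·X` (`X = x/log x`), i.e. the
hypothesis of S4 with `c = ηc₀/2`; S4 gives `TwinLowerDensity`.

Sizes: S1 XL (the sieve bookkeeping: FL + BV + corner upper bounds), S2 L (λ over rough numbers à la
Alladi, in progressions to tiny moduli, + the corner census), S3 L (model asymptotics by type + a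
certified bound `2M₃(1/5) < 1`, margin 0.36), S4 S/M (elementary). Hardest: S1.
Every analytic input is classical and parity-free: S1–S4 are expected to be THEOREMS (the crux is
the route's unconditional half; all parity content of the route sits in `PintzDensity`).

Sanity (no `sorry`): the five `*_iff` bridges are `Iff.rfl` (the stub signatures — β-redexes over the
route's dictionary — and the route decls — `let` chains — are both definitionally the helper-def forms
used in the composition). BC3 probes (registrar's NOTES.md / evidence `bc3_probes.md`):
for each stub `Sᵢ`, `Sᵢ → ParityLeakSieve` and `Sᵢ → GeneralizedHardyLittlewood` FAIL under the battery
`exact? | simpa | aesop | simpa [defs] | (unfold; aesop)`, one example per tactic (8/8 targets, 40/40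
examples; `exact?`: "could not close the goal" 8/8; `simpa`: 8/8; `aesop`: 8/8 — S4 by exhaustive search,
S1–S3 "error in norm simp: maximum number of steps exceeded" at 2·10⁶ heartbeats).

Disproof.lean: none exists for this crux (`ledger crux ls stmt-Parity-18381`: no workfiles at
registration) — no `_false_without_` obligations. Negatives index (3 entries: ConvMomentLevelOne,
TupleElliott (shift-uniform), RectangleChowla): none is a statement about the fixed-shift twin host's
sieve functionals; no stub restates one. Barriers: `Literature.Barriers.Parity.SelbergParityBarrier` /
`PrimePairParity` — S1 is an inequality valid for EVERY non-negative host with level-1/2 Type-I data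
and is tight on the parity host, S2/S3 are statements about the MODEL `b` only, S4 is elementary: the
skeleton claims no parity information (that is `E1NonSaturation`, the hypothesis of the crux);
`FordMaynardMinimalTypeII` — ν = 1/5 > ν₀(1/2) = 0.1663, and S3's constant is FM's C⁻(1/2,0,1/5) > 0
itself; `LogarithmicAveraging`, `CircleMethodBinaryBarrier`, `SiegelZero*` — not engaged (natural
density at each scale, no exponential sums, fixed shift 2).
-/

set_option linter.dupNamespace false

noncomputable section

open scoped BigOperators Classical

namespace Summit.Parity.GeneralizedHardyLittlewood.Cruxes.ParityLeakSieve.Birth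

open Summit.Parity.GeneralizedHardyLittlewood.Theses.ParityLeakOneFifth
  (E1NonSaturation TwinLowerDensity ParityLeakSieve)

/-! ## Registered stubs (`sorry` only here; signatures def-free, `let`-free and self-contained) -/

/-- **S1 — LOWER-BOUND SIEVE WITH TYPE-I INPUTS (the (W1) weight at (1/2, 0, 1/5), twin host).**
For every `δ > 0` there is `ε₂ > 0` such that for `0 < ε ≤ ε₂` and `x ≥ x₀(ε, δ)`:
`𝔐 − W_Φ − δ·x/log x ≤ T(x)`, where `𝔐 = ∑ b·Ψ(n+2)` is the model main term of the detected part
`Ψ = 1[P⁻ ≥ x^{1/5}]·M`, `W_Φ = ∑ Φ(n+2)(a − b)` the route's one Type-II functional and `T` the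
log-weighted twin count on `(x, 2x]`. Mechanism: `1[m prime] ≥ Ψ(m) − 32·1_E(m)` pointwise;
`Θ = Φ + Ψ = ∑_d μ(d) 1[P⁻(m/d) ≥ x^{ε²}]` is Type-I after the fundamental lemma (level `x^ε`,
`s = 1/ε`); remainders by Bombieri–Vinogradov (host, level `x^{1/2−ε}`) and equidistribution of
`z`-rough integers (model); corner set `E` by a 2-dimensional upper-bound sieve (`O(ε x/log x)`).
Why it might fail: only through a slip in the pointwise census of `Ψ` on `y`-rough types (checked:
`P₁…P₅`, non-squarefree) — every analytic input is a theorem. Sources: arXiv:2407.14368 §2.4,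
Harman2007 Ch. 3, HalberstamRichert1974 (Thm 2.5, fundamental lemma; Thm 3.12), Bombieri1965,
JurkatRichert1965. Size: XL. -/
theorem stub_sieveLowerBound : ∀ δ : ℝ, 0 < δ → ∃ ε₂ : ℝ, 0 < ε₂ ∧ ∀ ε : ℝ, 0 < ε → ε ≤ ε₂ → ∃ x₀ : ℕ, ∀ x : ℕ, x₀ ≤ x → (fun (b a Φ Ψ : ℕ → ℝ) => (∑ n ∈ Finset.Ioc x (2 * x), b n * Ψ (n + 2)) - (∑ n ∈ Finset.Ioc x (2 * x), Φ (n + 2) * (a n - b n)) - δ * (x : ℝ) / Real.log (x : ℝ) ≤ ∑ n ∈ (Finset.Ioc x (2 * x)).filter (fun n : ℕ => n.Prime ∧ (n + 2).Prime), Real.log (n : ℝ)) (fun n : ℕ => if ∀ p ∈ n.primeFactors, Real.exp (Real.log (Real.log (x : ℝ)) ^ 2) ≤ (p : ℝ) then 1 / (∏ p ∈ (Finset.range ⌈Real.exp (Real.log (Real.log (x : ℝ)) ^ 2)⌉₊).filter Nat.Prime, (1 - 1 / (p : ℝ))) else 0) (fun n : ℕ => if n.Prime then Real.log (n : ℝ)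 else 0) (fun m : ℕ => if (x : ℝ) ^ (ε ^ 2) ≤ (m.minFac : ℝ) ∧ (m.minFac : ℝ) < (x : ℝ) ^ ((1 : ℝ) / 5) then ∑ d ∈ (Nat.divisors m).filter (fun d : ℕ => (d : ℝ) ≤ (x : ℝ) ^ ((1 : ℝ) / 2 - 2 * ε) ∧ ∀ p ∈ d.primeFactors, (x : ℝ) ^ ((1 : ℝ) / 5) ≤ (p : ℝ)), (ArithmeticFunction.moebius d : ℝ) else 0) (fun m : ℕ => if (x : ℝ) ^ ((1 : ℝ) / 5) ≤ (m.minFac : ℝ) then ∑ d ∈ (Nat.divisors m).filter (fun d : ℕ => (d : ℝ) ≤ (x : ℝ) ^ ((1 : ℝ) / 2 - 2 * ε) ∧ ∀ p ∈ d.primeFactors, (x : ℝ) ^ ((1 : ℝ) / 5) ≤ (p : ℝ)), (ArithmeticFunction.moebius d : ℝ) else 0) := by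
  sorry

/-- **S2 — ZERO PARITY DEFECT AT ν = 1/5 (model-side identity, one-sided form consumed by the line).**
For every `δ > 0` there is `ε₂ > 0` such that for `0 < ε ≤ ε₂` and `x ≥ x₀(ε, δ)`:
`Π − δ·x/log x ≤ 𝔐`, i.e. `∑ b·λ(n+2)·Φ(n+2) ≤ ∑ b·Ψ(n+2) + δ x/log x` (the two-sided
`|𝔐 − Π| ≤ δ x/log x` is expected and proved the same way). Mechanism:
`𝔐 − Π = ∑ b(1+λ(n+2))Ψ(n+2) − ∑ bλ(n+2)Θ(n+2)`; `(1+λ)Ψ = 0` on squarefree `y`-rough `m` of odd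
type and `Ψ = 0` on generic even types (corners `O(ε)`); `∑ bλΘ` is `λ` over `x^{ε²}`-rough
cofactors (`u ≥ 1/(2ε²)`, Alladi–de Bruijn decay `ρ′(u)`) in progressions to the tiny moduli of the
`z`-sieve of `m − 2`. Why it might fail: a mis-count of an even type with `Ψ ≠ 0` of positive
measure (census says none), or loss of uniformity in the rough-`λ` estimate at moduli `z^{v}`.
Sources: Bombieri1976 (parity line), Alladi1982 (doi:10.1090/S0002-9947-1982-0662044-2),
Tenenbaum2015 III.6, arXiv:2407.14368 Thm 2.7(a). Size: L. -/
theorem stub_parityDefectZero : ∀ δ : ℝ, 0 < δ → ∃ ε₂ : ℝ, 0 < ε₂ ∧ ∀ ε : ℝ, 0 < ε → ε ≤ ε₂ → ∃ x₀ : ℕ, ∀ x : ℕ, x₀ ≤ x → (fun (b Φ Ψ : ℕ → ℝ) => (∑ n ∈ Finset.Ioc x (2 * x), b n * (ArithmeticFunction.liouville (n + 2) : ℝ) * Φ (n + 2)) - δ * (x : ℝ) / Real.log (x : ℝ) ≤ (∑ n ∈ Finset.Ioc x (2 * x), b n * Ψ (n + 2))) (fun n : ℕ => if ∀ p ∈ n.primeFactors,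 Real.exp (Real.log (Real.log (x : ℝ)) ^ 2) ≤ (p : ℝ) then 1 / (∏ p ∈ (Finset.range ⌈Real.exp (Real.log (Real.log (x : ℝ)) ^ 2)⌉₊).filter Nat.Prime, (1 - 1 / (p : ℝ))) else 0) (fun m : ℕ => if (x : ℝ) ^ (ε ^ 2) ≤ (m.minFac : ℝ) ∧ (m.minFac : ℝ) < (x : ℝ) ^ ((1 : ℝ) / 5) then ∑ d ∈ (Nat.divisors m).filter (fun d : ℕ => (d : ℝ) ≤ (x : ℝ) ^ ((1 : ℝ) / 2 - 2 * ε) ∧ ∀ p ∈ d.primeFactors, (x : ℝ) ^ ((1 : ℝ) / 5) ≤ (p : ℝ)), (ArithmeticFunction.moebius d : ℝ) else 0) (fun m : ℕ => if (x : ℝ) ^ ((1 : ℝ) / 5) ≤ (m.minFac : ℝ) then ∑ d ∈ (Nat.divisors m).filter (fun d : ℕ => (d : ℝ) ≤ (x : ℝ) ^ ((1 : ℝ) / 2 - 2 * ε) ∧ ∀ p ∈ d.primeFactors, (x : ℝ) ^ ((1 : ℝ) / 5) ≤ (p : ℝ)), (ArithmeticFunction.moebius d : ℝ) else 0) := by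
  sorry

/-- **S3 — CALIBRATION LOWER BOUND (the sieve constant is positive at ν = 1/5).** There are
`c₀ > 0` and `ε₃ > 0` such that for `0 < ε ≤ ε₃` and `x ≥ x₀(ε)`: `c₀·x/log x ≤ Π`. Mechanism:
`Π = 𝔖₂(1 − 2M₃(1/5) − O(ε) + o(1))·x/log x`, `𝔖₂ = 2∏_{p>2}(1 − 1/(p−1)²)` (density of `m − 2`
`z`-rough along primes / almost-primes `m`, against `1/V(z)`), `M₃(1/5) = 0.3189…` the logarithmic
measure of `p₁p₂p₃` with `x^{1/5} ≤ p₁ ≤ p₂ ≤ p₃ ≤ x^{1/2}` (each carrying `Ψ = −2`);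
`1 − 2M₃(1/5) = 0.362… > 0` needs only a crude certified bound (margin 0.36). Shared node with the
`PlainSplit` skeleton (`CalibrationLowerBound`). Why it might fail: only if `2M₃(1/5) ≥ 1`
(numerically false with two independent evaluations) or a mis-evaluated local factor. Sources:
arXiv:2407.14368 Thm 2.7(a), DukeFriedlanderIwaniec1997, HalberstamRichert1974. Size: L. -/
theorem stub_calibrationLowerBound : ∃ c₀ : ℝ, 0 < c₀ ∧ ∃ ε₃ : ℝ, 0 < ε₃ ∧ ∀ ε : ℝ, 0 < ε → ε ≤ ε₃ → ∃ x₀ : ℕ, ∀ x : ℕ, x₀ ≤ x → (fun (b Φ : ℕ → ℝ) => c₀ * (x : ℝ) / Real.log (x : ℝ) ≤ (∑ n ∈ Finset.Ioc x (2 * x), b n * (ArithmeticFunction.liouville (n + 2) : ℝ) * Φ (n + 2))) (fun n : ℕ => if ∀ p ∈ n.primeFactors, Real.exp (Real.log (Real.log (x : ℝ)) ^ 2) ≤ (p : ℝ) then 1 / (∏ p ∈ (Finset.range ⌈Real.exp (Real.log (Real.log (x : ℝ)) ^ 2)⌉₊).filter Nat.Prime, (1 - 1 / (p : ℝ))) else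 0) (fun m : ℕ => if (x : ℝ) ^ (ε ^ 2) ≤ (m.minFac : ℝ) ∧ (m.minFac : ℝ) < (x : ℝ) ^ ((1 : ℝ) / 5) then ∑ d ∈ (Nat.divisors m).filter (fun d : ℕ => (d : ℝ) ≤ (x : ℝ) ^ ((1 : ℝ) / 2 - 2 * ε) ∧ ∀ p ∈ d.primeFactors, (x : ℝ) ^ ((1 : ℝ) / 5) ≤ (p : ℝ)), (ArithmeticFunction.moebius d : ℝ) else 0) := by
  sorry

/-- **S4 — DYADIC LOG-WEIGHTED TWINS TO LOWER DENSITY (elementary).** If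
`T(x) = ∑_{x<n≤2x, n, n+2 prime} log n ≥ c·x/log x` for all large `x` (some `c > 0`), then
`π₂(x) ≥ c′·x/log²x` for all large `x`: take the window `(⌊x/2⌋, 2⌊x/2⌋] ⊆ [1, x]`, bound each
`log n ≤ log x`, and use `⌊x/2⌋ ≥ x/3`, `log⌊x/2⌋ ≤ log x`. Why it might fail: it cannot (casts and
floors only). Sources: HardyLittlewood1923 (π₂), Literature `twinPrimeCount`. Size: S/M. -/
theorem stub_windowToDensity : (∃ c : ℝ, 0 < c ∧ ∃ x₀ : ℕ, ∀ x : ℕ, x₀ ≤ x → c * (x : ℝ) / Real.log (x : ℝ) ≤ ∑ n ∈ (Finset.Ioc x (2 * x)).filter (fun n : ℕ => n.Prime ∧ (n + 2).Prime), Real.log (n : ℝ)) → Summit.Parity.GeneralizedHardyLittlewood.Theses.ParityLeakOneFifth.TwinLowerDensity := by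
  sorry

/-! ## Helper definitions (composition only; definitionally the stub dictionaries / route `let`s) -/

/-- `z = exp((log log x)²)`. -/
def zOf (x : ℕ) : ℝ := Real.exp (Real.log (Real.log (x : ℝ)) ^ 2)

/-- `V(z) = ∏_{p < ⌈z⌉, p prime} (1 − 1/p)`. -/
def VOf (x : ℕ) : ℝ := ∏ p ∈ (Finset.range ⌈zOf x⌉₊).filter Nat.Prime, (1 - 1 / (p : ℝ))

/-- Model `b n = 1[n is z-rough]/V(z)`. -/
def bOf (x : ℕ) : ℕ → ℝ := fun n => if ∀ p ∈ n.primeFactors, zOf x ≤ (p : ℝ) then 1 / VOf x else 0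

/-- Host `a n = Λ'(n)`. -/
def aOf : ℕ → ℝ := fun n => if n.Prime then Real.log (n : ℝ) else 0

/-- Truncated Möbius sum `M(m) = ∑_{d ∣ m, d ≤ x^{1/2−2ε}, d x^{1/5}-rough} μ(d)`. -/
def moebSum (ε : ℝ) (x : ℕ) (m : ℕ) : ℝ :=
  ∑ d ∈ (Nat.divisors m).filter (fun d : ℕ => (d : ℝ) ≤ (x : ℝ) ^ ((1 : ℝ) / 2 - 2 * ε) ∧
    ∀ p ∈ d.primeFactors, (x : ℝ) ^ ((1 : ℝ) / 5) ≤ (p : ℝ)), (ArithmeticFunction.moebius d : ℝ)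

/-- `Φ(m) = 1[x^{ε²} ≤ P⁻(m) < x^{1/5}]·M(m)` (the route's Type-II type function). -/
def PhiOf (ε : ℝ) (x : ℕ) : ℕ → ℝ := fun m =>
  if (x : ℝ) ^ (ε ^ 2) ≤ (m.minFac : ℝ) ∧ (m.minFac : ℝ) < (x : ℝ) ^ ((1 : ℝ) / 5) then moebSum ε x m
  else 0

/-- `Ψ(m) = 1[P⁻(m) ≥ x^{1/5}]·M(m)` (the detected part). -/
def PsiOf (ε : ℝ) (x : ℕ) : ℕ → ℝ := fun m =>
  if (x : ℝ) ^ ((1 : ℝ) / 5) ≤ (m.minFac : ℝ) then moebSum ε x m else 0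

/-- `W_Φ = ∑_{x<n≤2x} Φ(n+2)(a n − b n)`. -/
def WPhi (ε : ℝ) (x : ℕ) : ℝ := ∑ n ∈ Finset.Ioc x (2 * x), PhiOf ε x (n + 2) * (aOf n - bOf x n)

/-- `Π = ∑_{x<n≤2x} b n·λ(n+2)·Φ(n+2)`. -/
def PiOf (ε : ℝ) (x : ℕ) : ℝ :=
  ∑ n ∈ Finset.Ioc x (2 * x), bOf x n * (ArithmeticFunction.liouville (n + 2) : ℝ) * PhiOf ε x (n + 2)

/-- `𝔐 = ∑_{x<n≤2x} b n·Ψ(n+2)`. -/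
def ModelMain (ε : ℝ) (x : ℕ) : ℝ := ∑ n ∈ Finset.Ioc x (2 * x), bOf x n * PsiOf ε x (n + 2)

/-- `T(x) = ∑_{x<n≤2x, n and n+2 prime} log n`. -/
def twinLogSum (x : ℕ) : ℝ :=
  ∑ n ∈ (Finset.Ioc x (2 * x)).filter (fun n : ℕ => n.Prime ∧ (n + 2).Prime), Real.log (n : ℝ)

/-- `X(x) = x / log x`. -/
def XOf (x : ℕ) : ℝ := (x : ℝ) / Real.log (x : ℝ)

/-! ## Bridges (all `Iff.rfl`): the legends are definitionally the helper-def forms -/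

theorem e1NonSaturation_iff : E1NonSaturation ↔
    ∃ η : ℝ, 0 < η ∧ ∃ ε₁ : ℝ, 0 < ε₁ ∧ ∀ ε : ℝ, 0 < ε → ε ≤ ε₁ → ∃ x₀ : ℕ, ∀ x : ℕ, x₀ ≤ x →
      WPhi ε x ≤ (1 - η) * PiOf ε x :=
  Iff.rfl

theorem sieveLowerBound_iff : (∀ δ : ℝ, 0 < δ → ∃ ε₂ : ℝ, 0 < ε₂ ∧ ∀ ε : ℝ, 0 < ε → ε ≤ ε₂ → ∃ x₀ : ℕ, ∀ x : ℕ, x₀ ≤ x → (fun (b a Φ Ψ : ℕ → ℝ) => (∑ n ∈ Finset.Ioc x (2 * x), b n * Ψ (n + 2)) - (∑ n ∈ Finset.Ioc x (2 * x), Φ (n + 2) * (a n - b n)) - δ * (x : ℝ) / Real.log (x : ℝ) ≤ ∑ n ∈ (Finset.Ioc x (2 * x)).filter (fun n : ℕ => n.Prime ∧ (n + 2).Prime), Real.log (n : ℝ)) (fun n : ℕ => if ∀ p ∈ n.primeFactors, Real.exp (Real.log (Real.log (x : ℝ)) ^ 2) ≤ (p : ℝ) then 1 / (∏ p ∈ (Finset.range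 ⌈Real.exp (Real.log (Real.log (x : ℝ)) ^ 2)⌉₊).filter Nat.Prime, (1 - 1 / (p : ℝ))) else 0) (fun n : ℕ => if n.Prime then Real.log (n : ℝ) else 0) (fun m : ℕ => if (x : ℝ) ^ (ε ^ 2) ≤ (m.minFac : ℝ) ∧ (m.minFac : ℝ) < (x : ℝ) ^ ((1 : ℝ) / 5) then ∑ d ∈ (Nat.divisors m).filter (fun d : ℕ => (d : ℝ) ≤ (x : ℝ) ^ ((1 : ℝ) / 2 - 2 * ε) ∧ ∀ p ∈ d.primeFactors, (x : ℝ) ^ ((1 : ℝ) / 5) ≤ (p : ℝ)), (ArithmeticFunction.moebius d : ℝ) else 0) (fun m : ℕ => if (x : ℝ) ^ ((1 : ℝ) / 5) ≤ (m.minFac : ℝ) then ∑ d ∈ (Nat.divisors m).filter (fun d : ℕ => (d : ℝ) ≤ (x : ℝ) ^ ((1 : ℝ) / 2 - 2 * ε) ∧ ∀ p ∈ d.primeFactors, (x : ℝ) ^ ((1 : ℝ) / 5) ≤ (p : ℝ)), (ArithmeticFunction.moebius d : ℝ) else 0)) ↔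
    ∀ δ : ℝ, 0 < δ → ∃ ε₂ : ℝ, 0 < ε₂ ∧ ∀ ε : ℝ, 0 < ε → ε ≤ ε₂ → ∃ x₀ : ℕ, ∀ x : ℕ, x₀ ≤ x →
      ModelMain ε x - WPhi ε x - δ * (x : ℝ) / Real.log (x : ℝ) ≤ twinLogSum x :=
  Iff.rfl

theorem parityDefectZero_iff : (∀ δ : ℝ, 0 < δ → ∃ ε₂ : ℝ, 0 < ε₂ ∧ ∀ ε : ℝ, 0 < ε → ε ≤ ε₂ → ∃ x₀ : ℕ, ∀ x : ℕ, x₀ ≤ x → (fun (b Φ Ψ : ℕ → ℝ) => (∑ n ∈ Finset.Ioc x (2 * x), b n * (ArithmeticFunction.liouville (n + 2) : ℝ) * Φ (n + 2)) - δ * (x : ℝ) / Real.log (x : ℝ) ≤ (∑ n ∈ Finset.Ioc x (2 * x), b n * Ψ (n + 2))) (fun n : ℕ => if ∀ p ∈ n.primeFactors, Real.exp (Real.log (Real.log (x : ℝ)) ^ 2) ≤ (p : ℝ) then 1 / (∏ p ∈ (Finset.range ⌈Real.exp (Real.log (Real.log (x : ℝ)) ^ 2)⌉₊).filter Nat.Prime,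 (1 - 1 / (p : ℝ))) else 0) (fun m : ℕ => if (x : ℝ) ^ (ε ^ 2) ≤ (m.minFac : ℝ) ∧ (m.minFac : ℝ) < (x : ℝ) ^ ((1 : ℝ) / 5) then ∑ d ∈ (Nat.divisors m).filter (fun d : ℕ => (d : ℝ) ≤ (x : ℝ) ^ ((1 : ℝ) / 2 - 2 * ε) ∧ ∀ p ∈ d.primeFactors, (x : ℝ) ^ ((1 : ℝ) / 5) ≤ (p : ℝ)), (ArithmeticFunction.moebius d : ℝ) else 0) (fun m : ℕ => if (x : ℝ) ^ ((1 : ℝ) / 5) ≤ (m.minFac : ℝ) then ∑ d ∈ (Nat.divisors m).filter (fun d : ℕ => (d : ℝ) ≤ (x : ℝ) ^ ((1 : ℝ) / 2 - 2 * ε) ∧ ∀ p ∈ d.primeFactors, (x : ℝ) ^ ((1 : ℝ) / 5) ≤ (p : ℝ)), (ArithmeticFunction.moebius d : ℝ) else 0)) ↔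
    ∀ δ : ℝ, 0 < δ → ∃ ε₂ : ℝ, 0 < ε₂ ∧ ∀ ε : ℝ, 0 < ε → ε ≤ ε₂ → ∃ x₀ : ℕ, ∀ x : ℕ, x₀ ≤ x →
      PiOf ε x - δ * (x : ℝ) / Real.log (x : ℝ) ≤ ModelMain ε x :=
  Iff.rfl

theorem calibrationLowerBound_iff : (∃ c₀ : ℝ, 0 < c₀ ∧ ∃ ε₃ : ℝ, 0 < ε₃ ∧ ∀ ε : ℝ, 0 < ε → ε ≤ ε₃ → ∃ x₀ : ℕ, ∀ x : ℕ, x₀ ≤ x → (fun (b Φ : ℕ → ℝ) => c₀ * (x : ℝ) / Real.log (x : ℝ) ≤ (∑ n ∈ Finset.Ioc x (2 * x), b n * (ArithmeticFunction.liouville (n + 2) : ℝ) * Φ (n + 2))) (fun n : ℕ => if ∀ p ∈ n.primeFactors, Real.exp (Real.log (Real.log (x : ℝ)) ^ 2) ≤ (p : ℝ) then 1 / (∏ p ∈ (Finset.range ⌈Real.exp (Real.log (Real.log (x : ℝ)) ^ 2)⌉₊).filter Nat.Prime, (1 - 1 / (p : ℝ))) else 0) (fun m : ℕ => if (x : ℝ)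 ^ (ε ^ 2) ≤ (m.minFac : ℝ) ∧ (m.minFac : ℝ) < (x : ℝ) ^ ((1 : ℝ) / 5) then ∑ d ∈ (Nat.divisors m).filter (fun d : ℕ => (d : ℝ) ≤ (x : ℝ) ^ ((1 : ℝ) / 2 - 2 * ε) ∧ ∀ p ∈ d.primeFactors, (x : ℝ) ^ ((1 : ℝ) / 5) ≤ (p : ℝ)), (ArithmeticFunction.moebius d : ℝ) else 0)) ↔
    ∃ c₀ : ℝ, 0 < c₀ ∧ ∃ ε₃ : ℝ, 0 < ε₃ ∧ ∀ ε : ℝ, 0 < ε → ε ≤ ε₃ → ∃ x₀ : ℕ, ∀ x : ℕ, x₀ ≤ x →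
      c₀ * (x : ℝ) / Real.log (x : ℝ) ≤ PiOf ε x :=
  Iff.rfl

theorem windowToDensity_iff : ((∃ c : ℝ, 0 < c ∧ ∃ x₀ : ℕ, ∀ x : ℕ, x₀ ≤ x → c * (x : ℝ) / Real.log (x : ℝ) ≤ ∑ n ∈ (Finset.Ioc x (2 * x)).filter (fun n : ℕ => n.Prime ∧ (n + 2).Prime), Real.log (n : ℝ)) → Summit.Parity.GeneralizedHardyLittlewood.Theses.ParityLeakOneFifth.TwinLowerDensity) ↔
    ((∃ c : ℝ, 0 < c ∧ ∃ x₀ : ℕ, ∀ x : ℕ, x₀ ≤ x → c * (x : ℝ) / Real.log (x : ℝ) ≤ twinLogSum x) →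
      TwinLowerDensity) :=
  Iff.rfl

/-! ## Composition: the crux BY NAME from the four stubs (real proof, no `sorry`) -/

/-- **ParityLeakSieve from S1–S4.** From `E1NonSaturation` take `η, ε₁`; from S3 `c₀, ε₃`; feed
`δ = ηc₀/4` to S1 and S2; at `ε = min (min ε₁ ε₂) (min ε₂' ε₃)` and `x` beyond the four thresholds,
`T ≥ 𝔐 − W_Φ − δX ≥ (Π − δX) − (1 − η)Π − δX = ηΠ − 2δX ≥ (ηc₀/2)X`; S4 turns this dyadic
log-weighted bound into `TwinLowerDensity`. -/
theorem ParityLeakSieve_of :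
    (∀ δ : ℝ, 0 < δ → ∃ ε₂ : ℝ, 0 < ε₂ ∧ ∀ ε : ℝ, 0 < ε → ε ≤ ε₂ → ∃ x₀ : ℕ, ∀ x : ℕ, x₀ ≤ x → (fun (b a Φ Ψ : ℕ → ℝ) => (∑ n ∈ Finset.Ioc x (2 * x), b n * Ψ (n + 2)) - (∑ n ∈ Finset.Ioc x (2 * x), Φ (n + 2) * (a n - b n)) - δ * (x : ℝ) / Real.log (x : ℝ) ≤ ∑ n ∈ (Finset.Ioc x (2 * x)).filter (fun n : ℕ => n.Prime ∧ (n + 2).Prime), Real.log (n : ℝ)) (fun n : ℕ => if ∀ p ∈ n.primeFactors, Real.exp (Real.log (Real.log (x : ℝ)) ^ 2) ≤ (p : ℝ) then 1 / (∏ p ∈ (Finset.range ⌈Real.exp (Real.log (Real.log (x : ℝ)) ^ 2)⌉₊).filter Nat.Prime, (1 - 1 / (p : ℝ))) else 0) (fun n : ℕ => if n.Prime then Real.log (n : ℝ) else 0) (fun m : ℕ => if (x : ℝ) ^ (ε ^ 2) ≤ (m.minFac : ℝ) ∧ (m.minFac : ℝ) < (x : ℝ) ^ ((1 : ℝ) /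 5) then ∑ d ∈ (Nat.divisors m).filter (fun d : ℕ => (d : ℝ) ≤ (x : ℝ) ^ ((1 : ℝ) / 2 - 2 * ε) ∧ ∀ p ∈ d.primeFactors, (x : ℝ) ^ ((1 : ℝ) / 5) ≤ (p : ℝ)), (ArithmeticFunction.moebius d : ℝ) else 0) (fun m : ℕ => if (x : ℝ) ^ ((1 : ℝ) / 5) ≤ (m.minFac : ℝ) then ∑ d ∈ (Nat.divisors m).filter (fun d : ℕ => (d : ℝ) ≤ (x : ℝ) ^ ((1 : ℝ) / 2 - 2 * ε) ∧ ∀ p ∈ d.primeFactors, (x : ℝ) ^ ((1 : ℝ) / 5) ≤ (p : ℝ)), (ArithmeticFunction.moebius d : ℝ) else 0)) →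
    (∀ δ : ℝ, 0 < δ → ∃ ε₂ : ℝ, 0 < ε₂ ∧ ∀ ε : ℝ, 0 < ε → ε ≤ ε₂ → ∃ x₀ : ℕ, ∀ x : ℕ, x₀ ≤ x → (fun (b Φ Ψ : ℕ → ℝ) => (∑ n ∈ Finset.Ioc x (2 * x), b n * (ArithmeticFunction.liouville (n + 2) : ℝ) * Φ (n + 2)) - δ * (x : ℝ) / Real.log (x : ℝ) ≤ (∑ n ∈ Finset.Ioc x (2 * x), b n * Ψ (n + 2))) (fun n : ℕ => if ∀ p ∈ n.primeFactors, Real.exp (Real.log (Real.log (x : ℝ)) ^ 2) ≤ (p : ℝ) then 1 / (∏ p ∈ (Finset.range ⌈Real.exp (Real.log (Real.log (x : ℝ)) ^ 2)⌉₊).filter Nat.Prime, (1 - 1 / (p : ℝ))) else 0) (fun m : ℕ => if (x : ℝ) ^ (ε ^ 2) ≤ (m.minFac : ℝ) ∧ (m.minFac : ℝ) < (x : ℝ) ^ ((1 : ℝ) / 5) then ∑ d ∈ (Nat.divisors m).filter (fun d : ℕ => (d : ℝ) ≤ (x : ℝ) ^ ((1 : ℝ) / 2 - 2 * ε) ∧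 ∀ p ∈ d.primeFactors, (x : ℝ) ^ ((1 : ℝ) / 5) ≤ (p : ℝ)), (ArithmeticFunction.moebius d : ℝ) else 0) (fun m : ℕ => if (x : ℝ) ^ ((1 : ℝ) / 5) ≤ (m.minFac : ℝ) then ∑ d ∈ (Nat.divisors m).filter (fun d : ℕ => (d : ℝ) ≤ (x : ℝ) ^ ((1 : ℝ) / 2 - 2 * ε) ∧ ∀ p ∈ d.primeFactors, (x : ℝ) ^ ((1 : ℝ) / 5) ≤ (p : ℝ)), (ArithmeticFunction.moebius d : ℝ) else 0)) →
    (∃ c₀ : ℝ, 0 < c₀ ∧ ∃ ε₃ : ℝ, 0 < ε₃ ∧ ∀ ε : ℝ, 0 < ε → ε ≤ ε₃ → ∃ x₀ : ℕ, ∀ x : ℕ, x₀ ≤ x → (fun (b Φ : ℕ → ℝ) => c₀ * (x : ℝ) / Real.log (x : ℝ) ≤ (∑ n ∈ Finset.Ioc x (2 * x), b n * (ArithmeticFunction.liouville (n + 2) : ℝ) * Φ (n + 2))) (fun n : ℕ => if ∀ p ∈ n.primeFactors, Real.exp (Real.log (Real.log (x : ℝ)) ^ 2) ≤ (p : ℝ)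 then 1 / (∏ p ∈ (Finset.range ⌈Real.exp (Real.log (Real.log (x : ℝ)) ^ 2)⌉₊).filter Nat.Prime, (1 - 1 / (p : ℝ))) else 0) (fun m : ℕ => if (x : ℝ) ^ (ε ^ 2) ≤ (m.minFac : ℝ) ∧ (m.minFac : ℝ) < (x : ℝ) ^ ((1 : ℝ) / 5) then ∑ d ∈ (Nat.divisors m).filter (fun d : ℕ => (d : ℝ) ≤ (x : ℝ) ^ ((1 : ℝ) / 2 - 2 * ε) ∧ ∀ p ∈ d.primeFactors, (x : ℝ) ^ ((1 : ℝ) / 5) ≤ (p : ℝ)), (ArithmeticFunction.moebius d : ℝ) else 0)) →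
    ((∃ c : ℝ, 0 < c ∧ ∃ x₀ : ℕ, ∀ x : ℕ, x₀ ≤ x → c * (x : ℝ) / Real.log (x : ℝ) ≤ ∑ n ∈ (Finset.Ioc x (2 * x)).filter (fun n : ℕ => n.Prime ∧ (n + 2).Prime), Real.log (n : ℝ)) → Summit.Parity.GeneralizedHardyLittlewood.Theses.ParityLeakOneFifth.TwinLowerDensity) →
      Summit.Parity.GeneralizedHardyLittlewood.Theses.ParityLeakOneFifth.ParityLeakSieve := by
  intro h₁ h₂ h₃ h₄ hE
  rw [sieveLowerBound_iff] at h₁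
  rw [parityDefectZero_iff] at h₂
  rw [calibrationLowerBound_iff] at h₃
  rw [windowToDensity_iff] at h₄
  rw [e1NonSaturation_iff] at hE
  obtain ⟨η, hη, ε₁, hε₁, hE⟩ := hE
  obtain ⟨c₀, hc₀, ε₃, hε₃, hC⟩ := h₃
  have hδ : 0 < η * c₀ / 4 := by positivity
  obtain ⟨ε₂, hε₂, hS⟩ := h₁ (η * c₀ / 4) hδ
  obtain ⟨ε₂', hε₂', hP⟩ := h₂ (η * c₀ / 4) hδ
  obtain ⟨ε, hεpos, hle₁, hle₂, hle₂', hle₃⟩ :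
      ∃ ε : ℝ, 0 < ε ∧ ε ≤ ε₁ ∧ ε ≤ ε₂ ∧ ε ≤ ε₂' ∧ ε ≤ ε₃ :=
    ⟨min (min ε₁ ε₂) (min ε₂' ε₃), lt_min (lt_min hε₁ hε₂) (lt_min hε₂' hε₃),
      (min_le_left _ _).trans (min_le_left _ _), (min_le_left _ _).trans (min_le_right _ _),
      (min_le_right _ _).trans (min_le_left _ _), (min_le_right _ _).trans (min_le_right _ _)⟩
  obtain ⟨x₁, hx₁⟩ := hE ε hεpos hle₁
  obtain ⟨x₂, hx₂⟩ := hS ε hεpos hle₂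
  obtain ⟨x₃, hx₃⟩ := hP ε hεpos hle₂'
  obtain ⟨x₄, hx₄⟩ := hC ε hεpos hle₃
  apply h₄
  refine ⟨η * c₀ / 2, by positivity, max (max x₁ x₂) (max x₃ x₄), fun x hx => ?_⟩
  have hx₁' : x₁ ≤ x := ((le_max_left _ _).trans (le_max_left _ _)).trans hx
  have hx₂' : x₂ ≤ x := ((le_max_right _ _).trans (le_max_left _ _)).trans hx
  have hx₃' : x₃ ≤ x := ((le_max_left _ _).trans (le_max_right _ _)).trans hx
  have hx₄' : x₄ ≤ x := ((le_max_right _ _).trans (le_max_right _ _)).trans hx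
  -- W_Φ ≤ (1 − η)Π ;  𝔐 − W_Φ − δX ≤ T ;  Π − δX ≤ 𝔐 ;  c₀X ≤ Π
  have hW := hx₁ x hx₁'
  have hT := hx₂ x hx₂'
  have hM := hx₃ x hx₃'
  have hPi := hx₄ x hx₄'
  have key : ∀ t : ℝ, t * (x : ℝ) / Real.log (x : ℝ) = t * XOf x := fun t =>
    mul_div_assoc t (x : ℝ) (Real.log (x : ℝ))
  rw [key] at hT hM hPi ⊢
  have hEtaPi : η * (c₀ * XOf x) ≤ η * PiOf ε x := mul_le_mul_of_nonneg_left hPi hη.le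
  linarith [hW, hT, hM, hEtaPi]

/-- The crux by name, closed modulo the four registered stubs (checks that the hypotheses of
`ParityLeakSieve_of` are the stub signatures verbatim). -/
theorem parityLeakSieve_of_stubs :
    Summit.Parity.GeneralizedHardyLittlewood.Theses.ParityLeakOneFifth.ParityLeakSieve :=
  ParityLeakSieve_of stub_sieveLowerBound stub_parityDefectZero stub_calibrationLowerBound
    stub_windowToDensity

end Summit.Parity.GeneralizedHardyLittlewood.Cruxes.ParityLeakSieve.Birth

end
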